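import Literature.Analysis.FluidPDE.MikadoDataIteration
import Literature.Analysis.FluidPDE.OnsagerBDSVBiotSavart
import HarnessLib

/-!
# The heat-dominated blocks `v_k(t) = φ_k ∗ curl curl ∑_j a_{j,k} Ψ_{j,k}(t)` of Coiculescu–Palasek
# (Def. 3.10) and their all-orders bounds `‖∇ᵐv_k‖_∞ ≲ N_k^{1+m} e^{-N_k²t}` ((vkbounds))

Analysis/FluidPDE support file (definitions with proved API; no named facts) on the discharge path of
the principal-parts hypothesis `hA` of
`Literature.Barriers.NavierStokesRegularity.CriticalDataSmoothNonuniqueness_of_principalParts_of_perturbationLe`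
(M. P. Coiculescu, S. Palasek, *Non-uniqueness of smooth solutions of the Navier–Stokes equations from
critical data*, Invent. Math. 244 (2025), arXiv:2503.14699). **Def. 3.1**: "the (approximately) heat
evolved potential `Ψ_{j,k}(x,t) = Ψ⁰_{j,k}(x) exp(-|η_j|²N_k²t)`"; **Def. 3.10**: "the heat-dominated evolution
`v_k(t,x) = curl curl φ_k ∗ ∑_j a_{j,k}(x) Ψ_{j,k}(x,t)`"; proof of **Prop. 3.13**: "It follows from (abounds)
and (mikadoprofilebound) that `‖∇ᵐ v_k‖_{L^∞} ≲ N_k^{1+m} e^{-N_k²t}`" ((vkbounds)). On the unit torus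
`(ℝ/ℤ)³` the heat rate of the phase `e_{Nη}` is `4π²N²|η|²` (`Δ e_{Nη} = -4π²N²|η|² e_{Nη}`).

Since time enters only through the scalar factors `exp(-4π²N_k²|η_j|²t)`, one per pipe direction, the
block is a finite combination of FIXED smooth fields:

* `CP25.IterData.rate k j = 4π² N_k² |η_j|²` (the heat rate of `Ψ_{j,k}`);
* `CP25.IterData.Vfield k j = k_{ℓ_k} ⋆ curl curl (a_{j,k} Ψ⁰_{j,k})` (the time-independent `j`-th piece);
* `CP25.IterData.vHeat k t = ∑_j e^{-rate_{k,j} t} Vfield k j` (`= v_k(t)`; `vHeat_zero`: `v_k(0) = k_ℓ ⋆ curl curl g_k`);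
* `CP25.IterData.Admissible.hasLiftDerivBounds_Vfield` — **(vkbounds), all orders, uniform in `k`**:
  `HasLiftDerivBounds n (Vfield k j) (Cᵥ_n N_k) (κ_{n+2} N_k)`, i.e. `‖Dⁱ Vfield‖ ≤ Cᵥ_n κ_{n+2}ⁱ N_k^{1+i}`
  (two derivatives of `curl curl` on `a_{j,k}Ψ⁰_{j,k} ∈ HasLiftDerivBounds (n+2) (C N_k⁻¹) (κN_k)`, the
  mollifier not increasing any `‖Dⁱ·‖_∞`);
* `CP25.IterData.Admissible.hasLiftDerivBounds_vHeat` — `HasLiftDerivBounds n (v_k(t)) (6Cᵥ_n N_k e^{-4π²N_k²t}) (κ_{n+2}N_k)`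
  for `t ≥ 0` (`rate ≥ 4π²N_k²` as `|η_j|² ≥ 1`), the input of the lacunary summation (3.13a)
  (`LacunarySmoothSeries`);
* structure: `Vfield` and `vHeat k t` are divergence free (`div` commutes with the mollifier,
  `div curl = 0`) and have zero mean (a curl integrates to zero), and are smooth.

## Mathlib / tree search

Tree: `CP25.IterData` with `amp`, `pipe`, `pre_eq_sum_amp_smul_pipe`, `hasLiftDerivBounds_amp_succ`,
`hasLiftDerivBounds_pipe` (`MikadoDataIteration`), `Torus.HasLiftDerivBounds` algebra
(`TorusLiftDerivBounds`), `BDSV.curl`, `BDSV.curlMatrix`, `BDSV.jacobian`, `BDSV.divergence_curl`,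
`BDSV.isSmooth_curl` (`OnsagerBDSVBiotSavart`), `Torus.partialDeriv_convolution`,
`Torus.integral_partialDeriv_eq_zero_holds`. Mathlib: `MeasureTheory.integral_convolution`.
`lean search 'vHeat|Vfield|heat-dominated'`: nothing prior.

## On the hypothesis `h : I.Admissible`

`CP25.IterData.Admissible I` (a `structure … : Prop` of `MikadoDataIteration`) bundles the standing
HYPOTHESES on the abstract inputs `I` (profile bounds, unit phases, positive averages, scale relations,
cut-off bounds); the theorems below take `h : I.Admissible` as a section hypothesis (`variable … include h`).
It is not a named fact and nothing here assumes a conclusion: the predicate is PROVED for the paper's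
concrete inputs in `CP25.admissible_mkIter` (`MikadoInputs`), which is how these theorems are used.

## References

* M. P. Coiculescu, S. Palasek, Invent. Math. 244 (2025) 165–219, doi:10.1007/s00222-025-01396-z,
  arXiv:2503.14699: Def. 3.1 (`Ψ_{j,k}(t)`), Def. 3.10 (`v_k`), Rmk. 3.11, Prop. 3.13 (proof, (vkbounds)).
  [CoiculescuPalasek2025]
-/

noncomputable section

open Set Function MeasureTheory Filter UnitAddTorus
open scoped BigOperators ContDiff Convolution Topology

namespace Literature.Analysis.FluidPDE

namespace CP25

open Literature.Analysis.FunctionSpaces Literature.Analysis.FunctionSpaces.Torus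

/-! ## `curl` and `curl curl` in the `HasLiftDerivBounds` currency -/

section Curl

variable {n : ℕ} {v : UnitAddTorus (Fin 3) → EuclideanSpace ℝ (Fin 3)} {C L : ℝ}

/-- `‖BDSV.curlMatrix‖ ≤ 4` (each coordinate of `BDSV.curlMatrix D` is a difference of two entries of `D`).
[folklore] -/
theorem norm_BDSV.curlMatrix_le : ‖BDSV.curlMatrix‖ ≤ 4 := by
  refine ContinuousLinearMap.opNorm_le_bound _ (by norm_num) fun D => ?_
  have hD : ∀ k i, |D k i| ≤ ‖D‖ := fun k i =>
    (norm_le_pi_norm (D k) i).trans (norm_le_pi_norm D k) |> fun h => by rwa [Real.norm_eq_abs] at h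
  rw [BDSV.curlMatrix_apply, EuclideanSpace.norm_eq]
  have hsum : ∑ i : Fin 3, ‖(![D 1 2 - D 2 1, D 2 0 - D 0 2, D 0 1 - D 1 0] : Fin 3 → ℝ) i‖ ^ 2 ≤ (4 * ‖D‖) ^ 2 := by
    simp only [Fin.sum_univ_three, Matrix.cons_val_zero, Matrix.cons_val_one, Matrix.cons_val_two,
      Matrix.tail_cons, Matrix.head_cons, Real.norm_eq_abs]
    have h12 := hD 1 2; have h21 := hD 2 1; have h20 := hD 2 0; have h02 := hD 0 2
    have h01 := hD 0 1; have h10 := hD 1 0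
    have e1 : |D 1 2 - D 2 1| ≤ 2 * ‖D‖ := (abs_sub _ _).trans (by linarith)
    have e2 : |D 2 0 - D 0 2| ≤ 2 * ‖D‖ := (abs_sub _ _).trans (by linarith)
    have e3 : |D 0 1 - D 1 0| ≤ 2 * ‖D‖ := (abs_sub _ _).trans (by linarith)
    have hn := norm_nonneg D
    nlinarith [abs_nonneg (D 1 2 - D 2 1), abs_nonneg (D 2 0 - D 0 2), abs_nonneg (D 0 1 - D 1 0)]
  calc Real.sqrt (∑ i : Fin 3, ‖(WithLp.toLp 2 ![D 1 2 - D 2 1, D 2 0 - D 0 2, D 0 1 - D 1 0] : EuclideanSpace ℝ (Fin 3)) i‖ ^ 2)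
      ≤ Real.sqrt ((4 * ‖D‖) ^ 2) := Real.sqrt_le_sqrt (by simpa using hsum)
    _ = 4 * ‖D‖ := Real.sqrt_sq (by positivity)

/-- **The Jacobian in the currency**: from `HasLiftDerivBounds (n+1) v C L`,
`HasLiftDerivBounds n (BDSV.jacobian v) (C L) L`. [folklore] -/
theorem hasLiftDerivBounds_jacobian (hv : HasLiftDerivBounds (n + 1) v C L) (hL : 0 ≤ L) :
    HasLiftDerivBounds n (BDSV.jacobian v) (C * L) L := by
  have hC := hv.nonneg
  refine HasLiftDerivBounds.of_pi (fun k => ?_) (by positivity) hL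
  exact HasLiftDerivBounds.of_pi (fun i => (hv.partialDeriv k).apply_coord i) (by positivity) hL

/-- **`curl` in the currency**: from `HasLiftDerivBounds (n+1) v C L`, `HasLiftDerivBounds n (BDSV.curl v) (4 C L) L`.
[folklore] -/
theorem hasLiftDerivBounds_curl (hv : HasLiftDerivBounds (n + 1) v C L) (hL : 0 ≤ L) :
    HasLiftDerivBounds n (BDSV.curl v) (4 * (C * L)) L := by
  have h := (hasLiftDerivBounds_jacobian hv hL).clm_comp BDSV.curlMatrix
  rw [show (fun y => BDSV.curlMatrix (BDSV.jacobian v y)) = BDSV.curl v from rfl] at h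
  refine h.mono ?_ hL le_rfl
  have : 0 ≤ C * L := mul_nonneg hv.nonneg hL
  exact mul_le_mul_of_nonneg_right norm_BDSV.curlMatrix_le this

/-- **`curl curl` in the currency**: from `HasLiftDerivBounds (n+2) v C L`,
`HasLiftDerivBounds n (curl (BDSV.curl v)) (16 C L²) L`. [cite: CoiculescuPalasek2025, Rmk. 3.11] -/
theorem hasLiftDerivBounds_curl_curl (hv : HasLiftDerivBounds (n + 2) v C L) (hL : 0 ≤ L) :
    HasLiftDerivBounds n (BDSV.curl (BDSV.curl v)) (16 * (C * L ^ 2)) L := by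
  have h1 := hasLiftDerivBounds_curl hv hL
  have h2 := hasLiftDerivBounds_curl h1 hL
  refine ⟨h2.isSmooth, fun i hi y => (h2.bound hi y).trans (le_of_eq ?_)⟩
  ring

end Curl

/-! ## Mollification: divergence and mean -/

section Mollify

variable {ℓ : ℝ}

/-- `div (k_ℓ ⋆ u) = k_ℓ ⋆ div u` for smooth `u`. [folklore] -/
theorem divergence_kernel_convolution (hℓ : 0 < ℓ) (hℓ' : ℓ ≤ 1 / 4)
    {u : UnitAddTorus (Fin 3) → EuclideanSpace ℝ (Fin 3)} (hu : IsSmooth u) (x : UnitAddTorus (Fin 3)) :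
    Torus.divergence (kernel ℓ ⋆ u) x = (kernel ℓ ⋆ Torus.divergence u) x := by
  have hκi := (isSmooth_kernel (d := Fin 3) hℓ hℓ').integrable
  have hsm : IsSmooth (kernel ℓ ⋆ u) := isSmooth_convolution hκi hu
  rw [divergence_eq_sum_partialDeriv_apply (hsm.isContDiff (by simp))]
  have hd : Torus.divergence u = fun y => ∑ i, (fun z => Torus.partialDeriv i u z i) y :=
    funext fun y => divergence_eq_sum_partialDeriv_apply (hu.isContDiff (by simp)) y
  rw [hd, convolution_finset_sum_right hκi _ (fun i _ => ((hu.partialDeriv i).apply i).continuous)]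
  refine Finset.sum_congr rfl fun i _ => ?_
  rw [partialDeriv_convolution hκi (hu.isContDiff (by simp)) i,
    kernel_convolution_vec_apply hℓ hℓ' (hu.partialDeriv i).continuous x i]

/-- Mollifying a smooth divergence-free field gives a divergence-free field. [folklore] -/
theorem isDivFree_kernel_convolution (hℓ : 0 < ℓ) (hℓ' : ℓ ≤ 1 / 4)
    {u : UnitAddTorus (Fin 3) → EuclideanSpace ℝ (Fin 3)} (hu : IsSmooth u) (hdiv : Torus.IsDivFree u) :
    Torus.IsDivFree (kernel ℓ ⋆ u) := by
  intro x
  rw [divergence_kernel_convolution hℓ hℓ' hu, show Torus.divergence u = fun _ => (0 : ℝ) from funext hdiv]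
  simp [convolution_lsmul]

/-- Mollification preserves the integral: `∫ k_ℓ ⋆ u = ∫ u`. [folklore] -/
theorem integral_kernel_convolution {F : Type*} [NormedAddCommGroup F] [NormedSpace ℝ F] [CompleteSpace F]
    (hℓ : 0 < ℓ) (hℓ' : ℓ ≤ 1 / 4)
    {u : UnitAddTorus (Fin 3) → F} (hu : Continuous u) : ∫ x, (kernel ℓ ⋆ u) x = ∫ x, u x := by
  have hκi := (isSmooth_kernel (d := Fin 3) hℓ hℓ').integrable
  rw [integral_convolution (ContinuousLinearMap.lsmul ℝ ℝ) hκi hu.integrable_unitAddTorus,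
    ContinuousLinearMap.lsmul_apply, integral_kernel hℓ hℓ', one_smul]

/-- Mollifying a mean-zero field gives a mean-zero field. [folklore] -/
theorem hasZeroMean_kernel_convolution {F : Type*} [NormedAddCommGroup F] [NormedSpace ℝ F] [CompleteSpace F]
    (hℓ : 0 < ℓ) (hℓ' : ℓ ≤ 1 / 4)
    {u : UnitAddTorus (Fin 3) → F} (hu : Continuous u) (h0 : Torus.HasZeroMean u) :
    Torus.HasZeroMean (kernel ℓ ⋆ u) := by
  unfold Torus.HasZeroMean at h0 ⊢
  rw [integral_kernel_convolution hℓ hℓ' hu, h0]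

end Mollify

/-! ## Linearity of `curl` over finite sums; a curl has zero mean -/

/-- The Jacobian of a finite sum of `C¹` fields. [folklore] -/
theorem jacobian_finset_sum {ι : Type*} (s : Finset ι) {f : ι → UnitAddTorus (Fin 3) → EuclideanSpace ℝ (Fin 3)}
    (hf : ∀ i ∈ s, IsContDiff 1 (f i)) (x : UnitAddTorus (Fin 3)) :
    BDSV.jacobian (fun z => ∑ i ∈ s, f i z) x = ∑ i ∈ s, BDSV.jacobian (f i) x := by
  funext k l
  simp only [BDSV.jacobian, Finset.sum_apply]
  rw [partialDeriv_finset_sum s hf k x, WithLp.ofLp_sum, Finset.sum_apply]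

/-- The curl of a finite sum of `C¹` fields is the sum of the curls (twin of `BDSV.curl_finset_sum`
of `OnsagerBDSVCorrectorCurl`, re-derived from `partialDeriv_finset_sum` to keep the imports light).
[folklore] -/
theorem curl_finset_sum' {ι : Type*} (s : Finset ι) {f : ι → UnitAddTorus (Fin 3) → EuclideanSpace ℝ (Fin 3)}
    (hf : ∀ i ∈ s, IsContDiff 1 (f i)) (x : UnitAddTorus (Fin 3)) :
    BDSV.curl (fun z => ∑ i ∈ s, f i z) x = ∑ i ∈ s, BDSV.curl (f i) x := by
  rw [BDSV.curl_eq_curlMatrix_jacobian, jacobian_finset_sum s hf x, map_sum]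
  rfl

/-- Coordinates of a Bochner integral of an `ℝ³`-valued function. [folklore] -/
theorem integral_apply_coord' {f : UnitAddTorus (Fin 3) → EuclideanSpace ℝ (Fin 3)} (hf : Integrable f volume)
    (i : Fin 3) : (∫ x, f x) i = ∫ x, f x i := by
  have h := (EuclideanSpace.proj i : EuclideanSpace ℝ (Fin 3) →L[ℝ] ℝ).integral_comp_comm hf
  simpa using h.symm

/-- **A curl integrates to zero** on `T³` (each coordinate is a difference of partial derivatives,
which integrate to zero). [folklore] -/
theorem hasZeroMean_curl {v : UnitAddTorus (Fin 3) → EuclideanSpace ℝ (Fin 3)} (hv : IsSmooth v) :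
    Torus.HasZeroMean (BDSV.curl v) := by
  unfold Torus.HasZeroMean
  have hint : Integrable (BDSV.curl v) volume := (BDSV.isSmooth_curl hv).continuous.integrable_unitAddTorus
  have hP : ∀ a b : Fin 3, ∫ x, Torus.partialDeriv a v x b = (0 : ℝ) := by
    intro a b
    have h := integral_partialDeriv_eq_zero_holds (hv.apply b) a
    rw [show (fun x => Torus.partialDeriv a v x b) = Torus.partialDeriv a (fun y => v y b) from
      funext fun x => (partialDeriv_apply_coord (hv.isContDiff (by simp)) a x b).symm]
    exact h
  have hI : ∀ a b : Fin 3, Integrable (fun x => Torus.partialDeriv a v x b) volume :=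
    fun a b => ((hv.partialDeriv a).apply b).continuous.integrable_unitAddTorus
  ext i
  rw [integral_apply_coord' hint i, PiLp.zero_apply]
  fin_cases i
  · show ∫ x, BDSV.curl v x 0 = 0
    simp_rw [BDSV.curl_apply_zero]
    rw [integral_sub (hI 1 2) (hI 2 1), hP, hP, sub_zero]
  · show ∫ x, BDSV.curl v x 1 = 0
    simp_rw [BDSV.curl_apply_one]
    rw [integral_sub (hI 2 0) (hI 0 2), hP, hP, sub_zero]
  · show ∫ x, BDSV.curl v x 2 = 0
    simp_rw [BDSV.curl_apply_two]
    rw [integral_sub (hI 0 1) (hI 1 0), hP, hP, sub_zero]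

/-! ## The blocks -/

namespace IterData

variable (I : IterData)

/-- **The heat rate of `Ψ_{j,k}`**: `4π² N_k² |η_j|²` (Def. 3.1 on the unit torus: `Ψ_{j,k}(t) = Ψ⁰_{j,k} e^{-rate t}`).
[cite: CoiculescuPalasek2025, Def. 3.1] -/
def rate (k : ℕ) (j : Fin 6) : ℝ := 4 * Real.pi ^ 2 * (I.N k : ℝ) ^ 2 * normSqInt (nashNormal j)

/-- **The `j`-th fixed field of the heat block**: `V_{j,k} = k_{ℓ_k} ⋆ curl curl (a_{j,k} Ψ⁰_{j,k})`, so that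
`v_k(t) = ∑_j e^{-rate_{k,j} t} V_{j,k}` (Def. 3.10). [cite: CoiculescuPalasek2025, Def. 3.10] -/
def Vfield (k : ℕ) (j : Fin 6) : UnitAddTorus (Fin 3) → EuclideanSpace ℝ (Fin 3) :=
  kernel (I.ℓ k) ⋆ BDSV.curl (BDSV.curl fun x => I.amp k j x • I.pipe k j x)

/-- **The heat-dominated block `v_k(t) = φ_k ∗ curl curl ∑_j a_{j,k} Ψ_{j,k}(t)`** (Def. 3.10), written
as `∑_j e^{-rate_{k,j} t} V_{j,k}`. [cite: CoiculescuPalasek2025, Def. 3.10] -/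
def vHeat (k : ℕ) (t : ℝ) (x : UnitAddTorus (Fin 3)) : EuclideanSpace ℝ (Fin 3) :=
  ∑ j, Real.exp (-(I.rate k j * t)) • I.Vfield k j x

/-- `rate ≥ 4π² N_k²` (`|η_j|² ≥ 1`). [cite: CoiculescuPalasek2025, Def. 3.1] -/
theorem rate_ge (k : ℕ) (j : Fin 6) : 4 * Real.pi ^ 2 * (I.N k : ℝ) ^ 2 ≤ I.rate k j := by
  unfold rate
  have h := one_le_normSqInt_nashNormal j
  have : 0 ≤ 4 * Real.pi ^ 2 * (I.N k : ℝ) ^ 2 := by positivity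
  nlinarith

/-- `0 ≤ rate`. [folklore] -/
theorem rate_nonneg (k : ℕ) (j : Fin 6) : 0 ≤ I.rate k j :=
  le_trans (by positivity) (I.rate_ge k j)

/-- The time factor is at most `e^{-4π²N_k²t}` for `t ≥ 0`. [cite: CoiculescuPalasek2025, Prop. 3.13 (proof)] -/
theorem exp_neg_rate_le (k : ℕ) (j : Fin 6) {t : ℝ} (ht : 0 ≤ t) :
    Real.exp (-(I.rate k j * t)) ≤ Real.exp (-(4 * Real.pi ^ 2 * (I.N k : ℝ) ^ 2 * t)) := by
  rw [Real.exp_le_exp, neg_le_neg_iff]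
  exact mul_le_mul_of_nonneg_right (I.rate_ge k j) ht

/-- The time factor is at most `1` for `t ≥ 0`. [folklore] -/
theorem exp_neg_rate_le_one (k : ℕ) (j : Fin 6) {t : ℝ} (ht : 0 ≤ t) : Real.exp (-(I.rate k j * t)) ≤ 1 := by
  rw [Real.exp_le_one_iff, neg_nonpos]
  exact mul_nonneg (I.rate_nonneg k j) ht

end IterData

namespace IterConsts

variable (C : IterConsts)

/-- The uniform amplitude constant of the amplitudes: `Camp_n = max 1 (√D̄ (2π²c₀A₀)^{-1/2} ∑_j C_Γ(j,n))`
so that `|a_{j,k}|`-type bounds read `≤ Camp_n N_k` at every level including `k = 0`. [cite: CoiculescuPalasek2025, Prop. 3.13 (abounds)] -/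
def Camp (n : ℕ) : ℝ :=
  max 1 (Real.sqrt C.Dbar * Real.sqrt (2 * Real.pi ^ 2 * nashRadius * C.A₀)⁻¹ * ∑ j, nashFieldConst j n)

/-- `1 ≤ Camp_n`. [folklore] -/
theorem one_le_Camp (n : ℕ) : 1 ≤ C.Camp n := le_max_left _ _

/-- The uniform block constant `Cᵥ_n = 16 · 3 Camp_{n+2} G_{n+2} κ_{n+2}²`. [cite: CoiculescuPalasek2025, Prop. 3.13 (vkbounds)] -/
def Cv (n : ℕ) : ℝ := 16 * (3 * C.Camp (n + 2) * C.G (n + 2) * C.κ (n + 2) ^ 2)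

end IterConsts

namespace IterData

variable (I : IterData)

namespace Admissible

variable {I} (h : I.Admissible)
include h

/-- **The amplitudes at positive levels with the sharp frequency** ((abounds), all orders, uniform):
`HasLiftDerivBounds n a_{j,k+1} (Camp_n N_{k+1}) (2Λf_n(k))`. [cite: CoiculescuPalasek2025, Prop. 3.13 (abounds)] -/
theorem hasLiftDerivBounds_amp_succ_sharp (n k : ℕ) (j : Fin 6) :
    HasLiftDerivBounds n (I.amp (k + 1) j) (I.cst.Camp n * I.N (k + 1)) (2 * I.Λf n k) := by
  refine (h.hasLiftDerivBounds_amp_succ n k j).mono ?_ (by have := h.Λf_nonneg n k; positivity) le_rfl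
  have hS : 0 ≤ Real.sqrt (2 * Real.pi ^ 2 * nashRadius * I.cst.A₀)⁻¹ := by positivity
  have hDk : Real.sqrt (I.cst.Dseq k) ≤ Real.sqrt I.cst.Dbar := Real.sqrt_le_sqrt (h.Dseq_le_Dbar k)
  have hCj : nashFieldConst j n ≤ ∑ j', nashFieldConst j' n :=
    Finset.single_le_sum (fun j' _ => zero_le_one.trans (one_le_nashFieldConst j' n)) (Finset.mem_univ j)
  have h0 : 0 ≤ nashFieldConst j n := zero_le_one.trans (one_le_nashFieldConst j n)
  have hkey : Real.sqrt (I.cst.Dseq k) * Real.sqrt (2 * Real.pi ^ 2 * nashRadius * I.cst.A₀)⁻¹ * nashFieldConst j n ≤ I.cst.Camp n :=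
    calc Real.sqrt (I.cst.Dseq k) * Real.sqrt (2 * Real.pi ^ 2 * nashRadius * I.cst.A₀)⁻¹ * nashFieldConst j n
        ≤ Real.sqrt I.cst.Dbar * Real.sqrt (2 * Real.pi ^ 2 * nashRadius * I.cst.A₀)⁻¹ * nashFieldConst j n := by
          gcongr
      _ ≤ Real.sqrt I.cst.Dbar * Real.sqrt (2 * Real.pi ^ 2 * nashRadius * I.cst.A₀)⁻¹ * ∑ j', nashFieldConst j' n := by
          gcongr
      _ ≤ I.cst.Camp n := le_max_right _ _
  have hN := (h.N_pos' (k + 1)).le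
  calc (I.N (k + 1) : ℝ) * (Real.sqrt (I.cst.Dseq k) * Real.sqrt (2 * Real.pi ^ 2 * nashRadius * I.cst.A₀)⁻¹) * nashFieldConst j n
      = (Real.sqrt (I.cst.Dseq k) * Real.sqrt (2 * Real.pi ^ 2 * nashRadius * I.cst.A₀)⁻¹ * nashFieldConst j n) * I.N (k + 1) := by
        ring
    _ ≤ I.cst.Camp n * I.N (k + 1) := mul_le_mul_of_nonneg_right hkey hN

/-- **The amplitudes at every level in one shape** ((abounds), all orders, uniform):
`HasLiftDerivBounds n a_{j,k} (Camp_n N_k) (2(c̄_n + cχ_n) N_k)`. [cite: CoiculescuPalasek2025, Prop. 3.13 (abounds)] -/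
theorem hasLiftDerivBounds_amp (n : ℕ) : ∀ (k : ℕ) (j : Fin 6),
    HasLiftDerivBounds n (I.amp k j) (I.cst.Camp n * I.N k) (2 * ((derivProfileMassSup (Fin 3) n + I.cst.cχ n) * I.N k))
  | 0, j => by
    have hL : 0 ≤ 2 * ((derivProfileMassSup (Fin 3) n + I.cst.cχ n) * I.N 0) := by
      have := one_le_derivProfileMassSup (d := Fin 3) n; have := h.cχ_nonneg n; have := (h.N_pos' 0).le
      positivity
    have hc := hasLiftDerivBounds_const (d := Fin 3) n (if j = 0 then (I.N 0 : ℝ) else 0) hL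
    refine ⟨hc.isSmooth, fun i hi y => (hc.bound hi y).trans ?_⟩
    refine mul_le_mul_of_nonneg_right ?_ (pow_nonneg hL i)
    have hN := (h.N_pos' 0).le
    have h1 := I.cst.one_le_Camp n
    split_ifs
    · rw [Real.norm_eq_abs, abs_of_nonneg hN]; nlinarith
    · rw [norm_zero]; positivity
  | k + 1, j =>
    (h.hasLiftDerivBounds_amp_succ_sharp n k j).mono le_rfl (by have := h.Λf_nonneg n k; positivity)
      (by have := h.Λf_le n k; linarith)

/-- **The products `a_{j,k} Ψ⁰_{j,k}` in the currency**: `HasLiftDerivBounds n (a_{j,k}Ψ⁰_{j,k}) (3 Camp_n G_n N_k⁻¹) (κ_n N_k)`.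
[cite: CoiculescuPalasek2025, Prop. 3.13 (proof, (vkbounds))] -/
theorem hasLiftDerivBounds_amp_smul_pipe (n k : ℕ) (j : Fin 6) :
    HasLiftDerivBounds n (fun x => I.amp k j x • I.pipe k j x) (3 * I.cst.Camp n * I.cst.G n * ((I.N k : ℝ))⁻¹) (I.cst.κ n * I.N k) := by
  have hs := (h.hasLiftDerivBounds_amp n k j).smul (h.hasLiftDerivBounds_pipe n k j)
  rw [two_mul_add_eq (I := I) n k] at hs
  refine ⟨hs.isSmooth, fun i hi y => (hs.bound hi y).trans (le_of_eq ?_)⟩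
  have hN := (h.N_pos' k).ne'
  field_simp

/-- The products are smooth. [folklore] -/
theorem isSmooth_amp_smul_pipe (k : ℕ) (j : Fin 6) : IsSmooth fun x => I.amp k j x • I.pipe k j x :=
  (h.hasLiftDerivBounds_amp_smul_pipe 0 k j).isSmooth

/-- **(vkbounds), all orders, uniform in the level**: `HasLiftDerivBounds n V_{j,k} (Cᵥ_n N_k) (κ_{n+2} N_k)`,
i.e. `‖Dⁱ V_{j,k}‖_∞ ≤ Cᵥ_n κ_{n+2}ⁱ N_k^{1+i}` ("`‖∇ᵐv_k‖ ≲ N_k^{1+m}e^{-N_k²t}`" before the time factor).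
[cite: CoiculescuPalasek2025, Prop. 3.13 (proof, (vkbounds))] -/
theorem hasLiftDerivBounds_Vfield (n k : ℕ) (j : Fin 6) :
    HasLiftDerivBounds n (I.Vfield k j) (I.cst.Cv n * I.N k) (I.cst.κ (n + 2) * I.N k) := by
  have hL : 0 ≤ I.cst.κ (n + 2) * I.N k := by have := (h.κ_pos (n + 2)).le; have := (h.N_pos' k).le; positivity
  have hcc := hasLiftDerivBounds_curl_curl (h.hasLiftDerivBounds_amp_smul_pipe (n + 2) k j) hL
  have hm := hcc.kernel_convolution (h.ℓ_pos k) (h.ℓ_le k)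
  refine ⟨hm.isSmooth, fun i hi y => (hm.bound hi y).trans (le_of_eq ?_)⟩
  have hN := (h.N_pos' k).ne'
  simp only [IterConsts.Cv]
  field_simp

/-- `V_{j,k}` is smooth. [folklore] -/
theorem isSmooth_Vfield (k : ℕ) (j : Fin 6) : IsSmooth (I.Vfield k j) := (h.hasLiftDerivBounds_Vfield 0 k j).isSmooth

/-- **`V_{j,k}` is divergence free** (`div` commutes with the mollifier and `div curl = 0`).
[cite: CoiculescuPalasek2025, Prop. 3.13 ("the constituent parts … appear inside of curl")] -/
theorem isDivFree_Vfield (k : ℕ) (j : Fin 6) : Torus.IsDivFree (I.Vfield k j) := by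
  have hs := h.isSmooth_amp_smul_pipe k j
  exact isDivFree_kernel_convolution (h.ℓ_pos k) (h.ℓ_le k) (BDSV.isSmooth_curl (BDSV.isSmooth_curl hs))
    (BDSV.divergence_curl (BDSV.isSmooth_curl hs))

/-- **`V_{j,k}` has zero mean** (a curl integrates to zero; the mollifier preserves the integral).
[cite: CoiculescuPalasek2025, Rmk. 3.11 with Def. 3.10] -/
theorem hasZeroMean_Vfield (k : ℕ) (j : Fin 6) : Torus.HasZeroMean (I.Vfield k j) := by
  have hs := h.isSmooth_amp_smul_pipe k j
  exact hasZeroMean_kernel_convolution (h.ℓ_pos k) (h.ℓ_le k) (BDSV.isSmooth_curl (BDSV.isSmooth_curl hs)).continuous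
    (hasZeroMean_curl (BDSV.isSmooth_curl hs))

/-- **The heat block with its time factor in the currency**: for `t ≥ 0`,
`HasLiftDerivBounds n (v_k(t)) (6 Cᵥ_n N_k e^{-4π²N_k²t}) (κ_{n+2} N_k)` — the block bound
`‖∇ᵐv_k(t)‖_∞ ≲_m N_k^{1+m} e^{-4π²N_k²t}` of (vkbounds). [cite: CoiculescuPalasek2025, Prop. 3.13 (vkbounds)] -/
theorem hasLiftDerivBounds_vHeat (n k : ℕ) {t : ℝ} (ht : 0 ≤ t) :
    HasLiftDerivBounds n (I.vHeat k t)
      (6 * (I.cst.Cv n * I.N k * Real.exp (-(4 * Real.pi ^ 2 * (I.N k : ℝ) ^ 2 * t)))) (I.cst.κ (n + 2) * I.N k) := by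
  have hL : 0 ≤ I.cst.κ (n + 2) * I.N k := by have := (h.κ_pos (n + 2)).le; have := (h.N_pos' k).le; positivity
  have hterm : ∀ j ∈ (Finset.univ : Finset (Fin 6)),
      HasLiftDerivBounds n (fun x => Real.exp (-(I.rate k j * t)) • I.Vfield k j x)
        (I.cst.Cv n * I.N k * Real.exp (-(4 * Real.pi ^ 2 * (I.N k : ℝ) ^ 2 * t))) (I.cst.κ (n + 2) * I.N k) := by
    intro j _
    have h1 := (h.hasLiftDerivBounds_Vfield n k j).const_smul (Real.exp (-(I.rate k j * t)))
    refine h1.mono ?_ hL le_rfl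
    rw [abs_of_pos (Real.exp_pos _), mul_comm]
    have h0 : 0 ≤ I.cst.Cv n * I.N k := (h.hasLiftDerivBounds_Vfield n k j).nonneg
    exact mul_le_mul_of_nonneg_left (I.exp_neg_rate_le k j ht) h0
  have hs := HasLiftDerivBounds.sum Finset.univ hterm hL
  rw [Finset.sum_const, Finset.card_univ, Fintype.card_fin] at hs
  simp only [nsmul_eq_mul, Nat.cast_ofNat] at hs
  exact hs

/-- `v_k(t)` is smooth (for every real `t`). [cite: CoiculescuPalasek2025, §5] -/
theorem isSmooth_vHeat (k : ℕ) (t : ℝ) : IsSmooth (I.vHeat k t) := by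
  have hL : 0 ≤ I.cst.κ 2 * I.N k := by have := (h.κ_pos 2).le; have := (h.N_pos' k).le; positivity
  have hterm : ∀ j ∈ (Finset.univ : Finset (Fin 6)),
      HasLiftDerivBounds 0 (fun x => Real.exp (-(I.rate k j * t)) • I.Vfield k j x)
        (|Real.exp (-(I.rate k j * t))| * (I.cst.Cv 0 * I.N k)) (I.cst.κ 2 * I.N k) :=
    fun j _ => (h.hasLiftDerivBounds_Vfield 0 k j).const_smul _
  exact (HasLiftDerivBounds.sum Finset.univ hterm hL).isSmooth

/-- **`v_k(t)` is divergence free.** [cite: CoiculescuPalasek2025, Prop. 3.13] -/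
theorem isDivFree_vHeat (k : ℕ) (t : ℝ) : Torus.IsDivFree (I.vHeat k t) := by
  intro x
  have h1 : ∀ j, IsContDiff 1 (fun x => Real.exp (-(I.rate k j * t)) • I.Vfield k j x) :=
    fun j => ((h.isSmooth_Vfield k j).smul _).isContDiff (by simp)
  rw [divergence_eq_sum_partialDeriv_apply ((h.isSmooth_vHeat k t).isContDiff (by simp))]
  have hpd : ∀ i, Torus.partialDeriv i (I.vHeat k t) x i =
      ∑ j, Real.exp (-(I.rate k j * t)) * Torus.partialDeriv i (I.Vfield k j) x i := by
    intro i
    have hv : I.vHeat k t = fun y => ∑ j ∈ Finset.univ, (fun z => Real.exp (-(I.rate k j * t)) • I.Vfield k j z) y := rfl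
    rw [hv, partialDeriv_finset_sum Finset.univ (fun j _ => h1 j) i x, WithLp.ofLp_sum, Finset.sum_apply]
    refine Finset.sum_congr rfl fun j _ => ?_
    rw [show (fun z => Real.exp (-(I.rate k j * t)) • I.Vfield k j z) = Real.exp (-(I.rate k j * t)) • I.Vfield k j
      from rfl, partialDeriv_const_smul ((h.isSmooth_Vfield k j).isContDiff (by simp))]
    rfl
  simp_rw [hpd]
  rw [Finset.sum_comm]
  refine Finset.sum_eq_zero fun j _ => ?_
  rw [← Finset.mul_sum]
  have hdiv := h.isDivFree_Vfield k j x
  rw [divergence_eq_sum_partialDeriv_apply ((h.isSmooth_Vfield k j).isContDiff (by simp))] at hdiv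
  rw [hdiv, mul_zero]

/-- **`v_k(t)` has zero mean.** [cite: CoiculescuPalasek2025, Rmk. 3.11] -/
theorem hasZeroMean_vHeat (k : ℕ) (t : ℝ) : Torus.HasZeroMean (I.vHeat k t) := by
  unfold Torus.HasZeroMean
  have hint : ∀ j ∈ (Finset.univ : Finset (Fin 6)),
      Integrable (fun x => Real.exp (-(I.rate k j * t)) • I.Vfield k j x) volume :=
    fun j _ => (((h.isSmooth_Vfield k j).smul (Real.exp (-(I.rate k j * t)))).continuous).integrable_unitAddTorus
  calc ∫ x, I.vHeat k t x = ∫ x, ∑ j, (fun j y => Real.exp (-(I.rate k j * t)) • I.Vfield k j y) j x := rfl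
    _ = ∑ j, ∫ x, (fun j y => Real.exp (-(I.rate k j * t)) • I.Vfield k j y) j x := integral_finsetSum _ hint
    _ = 0 := Finset.sum_eq_zero fun j _ => by
        simp only [integral_smul]
        rw [h.hasZeroMean_Vfield k j, smul_zero]

/-- At `t = 0`: `v_k(0) = k_{ℓ_k} ⋆ curl curl g_k` (with `g_k = ∑_j a_{j,k}Ψ⁰_{j,k}`).
[cite: CoiculescuPalasek2025, Rmk. 3.12 ("`v_k(0,x) = curl curl ψ⁰_k`")] -/
theorem vHeat_zero (k : ℕ) (x : UnitAddTorus (Fin 3)) :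
    I.vHeat k 0 x = (kernel (I.ℓ k) ⋆ BDSV.curl (BDSV.curl (I.pre k))) x := by
  simp only [vHeat, mul_zero, neg_zero, Real.exp_zero, one_smul]
  have hs := h.isSmooth_amp_smul_pipe k
  have hκi := (isSmooth_kernel (d := Fin 3) (h.ℓ_pos k) (h.ℓ_le k)).integrable
  have hcc : BDSV.curl (BDSV.curl (I.pre k)) = fun x => ∑ j, BDSV.curl (BDSV.curl fun y => I.amp k j y • I.pipe k j y) x := by
    funext y
    rw [I.pre_eq_sum_amp_smul_pipe k]
    have h1 : BDSV.curl (fun z => ∑ j, I.amp k j z • I.pipe k j z) =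
        fun z => ∑ j, BDSV.curl (fun w => I.amp k j w • I.pipe k j w) z :=
      funext fun z => curl_finset_sum' Finset.univ (fun j _ => (hs j).isContDiff (by simp)) z
    rw [h1]
    exact curl_finset_sum' Finset.univ (fun j _ => (BDSV.isSmooth_curl (hs j)).isContDiff (by simp)) y
  rw [hcc, convolution_finset_sum_right hκi _ (fun j _ => (BDSV.isSmooth_curl (BDSV.isSmooth_curl (hs j))).continuous)]
  rfl

end Admissible

end IterData

end CP25

end Literature.Analysis.FluidPDE
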